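import Summits.QuantumFields.QCD.Theses.HeatSlicedQuarks
import Literature.MathematicalPhysics.QuantumLattice.OverlapLocality

/-!
# Negative lemmas for the crux `SmallFieldUltracontractivity` (stmt-QuantumFields-8871)

Load-bearing analysis of the order hypotheses of
`Summit.QuantumFields.QCD.Theses.HeatSlicedQuarks.SmallFieldUltracontractivity` (route
`HeatSlicedQuarks`, rank-2 crux), landed from the cdisprove work file
`Summits/QuantumFields/QCD/Cruxes/SmallFieldUltracontractivity/Disproof.lean`:

* `norm_exp_neg_smul_conjTranspose_mul_self_apply_le_one` — every entry of `exp(-t·AᴴA)` has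
  modulus `≤ 1` (`t ≥ 0`, any complex square matrix `A`); hence `kernelEntry_le_one`,
  `body_holds_at_fixed_volume` (at fixed `L` the inner statement holds with `C = L⁴`: only
  `L → ∞` families can refute the crux) and `posT_of_smallFieldUltracontractivity` (the lower
  window bound `1 ≤ t` is cosmetic: the crux implies its `0 < t` version with `C ↦ max C 1`);
* `smallFieldUltracontractivity_false_without_t_le_rsq`, `…_false_without_r_le_L`,
  `…_false_without_one_le_t` — each of the three order hypotheses `t ≤ r²`, `r ≤ L`, `1 ≤ t` is
  load-bearing AS TYPED, by the one-site torus `L = 1`, `U ≡ 1`, `m = 0`, where the tree's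
  `wilsonDirac` is the zero matrix (`wilsonDirac_freeCfg_one`) and the heat kernel is `1` for all
  `t` (for `1 ≤ t` only through `t ≤ 0`: at `t = 0` the typed bound reads `1 ≤ C/0 = 0`).

No statement of the route is asserted positively. [folklore]
-/


namespace Summit.QuantumFields.QCD.Theorems.SmallFieldUltracontractivity.Negative

open Literature.MathematicalPhysics.QuantumLattice Literature.MathematicalPhysics.QuantumFieldTheory
open Literature.Probability.LatticeModels (TorusSite)
open scoped Matrix Kronecker ComplexConjugate

noncomputable section

/-! ## §0 Vocabulary and the degenerate witness `L = 1`, `U ≡ 1`, `m = 0` -/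

/-- The colour group of the crux. -/
abbrev SU3 : Type := Matrix.specialUnitaryGroup (Fin 3) ℂ

/-- The free configuration `U ≡ 1` on the `L`-torus. -/
abbrev freeCfg (L : ℕ) : GaugeConfig 4 L SU3 := fun _ => 1

/-- The heat-kernel entry appearing in the crux, as a function of the data. -/
abbrev kernelEntry {L : ℕ} [NeZero L] (U : GaugeConfig 4 L SU3) (m t : ℝ) (x : TorusSite 4 L)
    (a b : Fin 3) (α β : Fin 4) : ℝ :=
  ‖(NormedSpace.exp (-(t : ℂ) • (Matrix.conjTranspose
      (wilsonDirac (fundamentalRep (Fin 3)) U m 1) * wilsonDirac (fundamentalRep (Fin 3)) U m 1)))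
    (x, a, α) (x, b, β)‖

/-- Every plaquette of the free configuration is trivial. -/
theorem plaquetteHolonomy_freeCfg (L : ℕ) (y : TorusSite 4 L) (μ ν : Fin 4) :
    plaquetteHolonomy (freeCfg L) y μ ν = 1 := by
  simp [plaquetteHolonomy]

/-- The free configuration has zero plaquette deficit (so it satisfies the smallness hypothesis of
the crux for every `ε`, `K`, `r`: the hypothesis is satisfiable, the crux is not vacuous). -/
theorem deficit_freeCfg (L : ℕ) (y : TorusSite 4 L) (μ ν : Fin 4) :
    3 - ((fundamentalRep (Fin 3)) (plaquetteHolonomy (freeCfg L) y μ ν)).trace.re = 0 := by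
  rw [plaquetteHolonomy_freeCfg, map_one, Matrix.trace_one]
  simp

/-- The smallness hypothesis of the crux holds for the free configuration. -/
theorem smallness_freeCfg (L : ℕ) (ε : ℝ) (K r : ℕ) (x : TorusSite 4 L) :
    ∀ y : TorusSite 4 L, torusDist x y ≤ K * r → ∀ μ ν : Fin 4,
      3 - ((fundamentalRep (Fin 3)) (plaquetteHolonomy (freeCfg L) y μ ν)).trace.re ≤
        (ε / (r : ℝ) ^ 2) ^ 2 := by
  intro y _ μ ν
  rw [deficit_freeCfg]
  positivity

/-- The one-site torus has a single site. -/
instance : Subsingleton (TorusSite 4 1) := by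
  haveI : Subsingleton (ZMod 1) := inferInstance
  infer_instance

/-- On the one-site torus the twisted shift of the free configuration is the identity. -/
theorem linkHop_freeCfg_one (μ : Fin 4) : linkHop (fundamentalRep (Fin 3)) (freeCfg 1) μ = 1 := by
  ext p q
  have h1 : p.1 = q.1 := Subsingleton.elim _ _
  simp only [linkHop, Matrix.of_apply, map_one, Matrix.one_apply, Prod.ext_iff, h1, true_and]
  rw [if_pos (Subsingleton.elim _ _)]

/-- On the one-site torus each Wilson hopping matrix of the free configuration is the identity
(`P⁻_μ + P⁺_μ = 1`). -/
theorem wilsonHop_freeCfg_one (μ : Fin 4) : wilsonHop (fundamentalRep (Fin 3)) (freeCfg 1) μ = 1 := by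
  rw [wilsonHop, linkHop_freeCfg_one, Matrix.conjTranspose_one, ← Matrix.kronecker_add,
    chiralProjMinus_add_chiralProjPlus, Matrix.one_kronecker_one, Matrix.reindex_apply,
    Matrix.submatrix_one_equiv]

/-- **Degenerate model.** On the one-site torus `L = 1` the tree's Wilson–Dirac operator of the
free configuration is the scalar `m`: the four hopping terms (both `if` branches fire, since
`Site.shift x μ = x`) exactly cancel the `4r` in the diagonal `m + 4r`. -/
theorem wilsonDirac_freeCfg_one (m : ℝ) :
    wilsonDirac (fundamentalRep (Fin 3)) (freeCfg 1) m 1 =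
      ((m : ℝ) : ℂ) • (1 : Matrix (TorusSite 4 1 × Fin 3 × Fin 4) (TorusSite 4 1 × Fin 3 × Fin 4) ℂ) := by
  rw [wilsonDirac_eq_sub_sum_wilsonHop (fundamentalRep (Fin 3)) fundamentalRep_mem_unitaryGroup
    (freeCfg 1) m]
  simp only [wilsonHop_freeCfg_one, Finset.sum_const, Finset.card_univ, Fintype.card_fin]
  rw [← Nat.cast_smul_eq_nsmul ℂ, ← sub_smul]
  congr 1
  push_cast
  ring

/-- At `m = 0` the one-site Wilson–Dirac operator vanishes identically. -/
theorem wilsonDirac_freeCfg_one_zero :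
    wilsonDirac (fundamentalRep (Fin 3)) (freeCfg 1) 0 1 = 0 := by
  rw [wilsonDirac_freeCfg_one]; simp

/-- Hence its heat kernel is the identity for EVERY real `t`: the on-diagonal entries have modulus
`1`, independently of `t`. -/
theorem kernelEntry_freeCfg_one_zero (t : ℝ) (x : TorusSite 4 1) (a : Fin 3) (α : Fin 4) :
    kernelEntry (freeCfg 1) 0 t x a a α α = 1 := by
  simp only [kernelEntry]
  rw [wilsonDirac_freeCfg_one_zero]
  simp

/-! ### Entries of `exp(-t·AᴴA)` are bounded by one (general linear algebra) -/

section EntryBound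

open scoped ComplexOrder

variable {ι : Type*} [Fintype ι] [DecidableEq ι]

/-- Row sums of squared moduli of a unitary matrix equal one. -/
theorem unitary_row_norm_sq (U : Matrix ι ι ℂ) (hU : U ∈ Matrix.unitaryGroup ι ℂ) (i : ι) :
    ∑ k, ‖U i k‖ ^ 2 = 1 := by
  have h := Matrix.mem_unitaryGroup_iff.mp hU
  have hii := congr_fun (congr_fun h i) i
  rw [Matrix.mul_apply, Matrix.one_apply_eq] at hii
  have hk : ∀ k, U i k * (star U) k i = ((‖U i k‖ ^ 2 : ℝ) : ℂ) := by
    intro k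
    rw [Matrix.star_apply, Complex.star_def, Complex.mul_conj, Complex.normSq_eq_norm_sq]
  simp_rw [hk] at hii
  rw [← Complex.ofReal_sum] at hii
  exact_mod_cast hii

/-- **Heat-kernel entries are bounded by one.** For every complex square matrix `A` and `t ≥ 0`,
every entry of `exp(-t · Aᴴ A)` has modulus `≤ 1` (spectral theorem `exp(-tAᴴA) = U e^{-tΛ} U*`
with `Λ ≥ 0`, then `|Σ_k U_ik e^{-tλ_k} conj(U_jk)| ≤ Σ_k |U_ik||U_jk| ≤ 1` by AM–GM and unit rows). -/
theorem norm_exp_neg_smul_conjTranspose_mul_self_apply_le_one (A : Matrix ι ι ℂ) {t : ℝ}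
    (ht : 0 ≤ t) (i j : ι) :
    ‖(NormedSpace.exp (-(t : ℂ) • (Aᴴ * A))) i j‖ ≤ 1 := by
  have hP : (Aᴴ * A).PosSemidef := Matrix.posSemidef_conjTranspose_mul_self A
  have hH : (Aᴴ * A).IsHermitian := hP.isHermitian
  set U : Matrix ι ι ℂ := (hH.eigenvectorUnitary : Matrix ι ι ℂ) with hUdef
  have hUmem : U ∈ Matrix.unitaryGroup ι ℂ := hH.eigenvectorUnitary.2
  have hUu : star U * U = 1 := Unitary.coe_star_mul_self hH.eigenvectorUnitary
  set w : ι → ℂ := fun k => Complex.exp (-(t : ℂ) * ((hH.eigenvalues k : ℝ) : ℂ)) with hw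
  have hspec : -(t : ℂ) • (Aᴴ * A) =
      U * Matrix.diagonal (fun k => -(t : ℂ) * ((hH.eigenvalues k : ℝ) : ℂ)) * star U := by
    have h0 : Aᴴ * A = U * Matrix.diagonal (fun k => ((hH.eigenvalues k : ℝ) : ℂ)) * star U := by
      conv_lhs => rw [hH.spectral_theorem, Unitary.conjStarAlgAut_apply]
      rfl
    conv_lhs => rw [h0]
    rw [← Matrix.smul_mul, ← Matrix.mul_smul, ← Matrix.diagonal_smul]
    rfl
  have hinv : U⁻¹ = star U := Matrix.inv_eq_left_inv hUu
  have hunit : IsUnit U := by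
    rw [Matrix.isUnit_iff_isUnit_det]
    exact Matrix.isUnit_det_of_left_inverse hUu
  have hwexp : NormedSpace.exp (fun k => -(t : ℂ) * ((hH.eigenvalues k : ℝ) : ℂ)) = w := by
    funext k
    rw [Pi.coe_exp, hw, Complex.exp_eq_exp_ℂ]
  have hexp : NormedSpace.exp (-(t : ℂ) • (Aᴴ * A)) = U * Matrix.diagonal w * star U := by
    rw [hspec, ← hinv, Matrix.exp_conj _ _ hunit, Matrix.exp_diagonal, hwexp]
  have hentry : (U * Matrix.diagonal w * star U) i j = ∑ k, U i k * w k * star (U j k) := by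
    rw [Matrix.mul_apply]
    refine Finset.sum_congr rfl fun k _ => ?_
    rw [Matrix.mul_diagonal, Matrix.star_apply]
  have hw1 : ∀ k, ‖w k‖ ≤ 1 := by
    intro k
    rw [hw]
    simp only [Complex.norm_exp]
    rw [Real.exp_le_one_iff]
    have h1 : (-(t : ℂ) * ((hH.eigenvalues k : ℝ) : ℂ)).re = -(t * hH.eigenvalues k) := by
      simp [Complex.mul_re]
    rw [h1, neg_nonpos]
    exact mul_nonneg ht (hP.eigenvalues_nonneg k)
  rw [hexp, hentry]
  calc ‖∑ k, U i k * w k * star (U j k)‖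
      ≤ ∑ k, ‖U i k * w k * star (U j k)‖ := norm_sum_le _ _
    _ ≤ ∑ k, ‖U i k‖ * ‖U j k‖ := by
        refine Finset.sum_le_sum fun k _ => ?_
        rw [norm_mul, norm_mul, norm_star]
        calc ‖U i k‖ * ‖w k‖ * ‖U j k‖ ≤ ‖U i k‖ * 1 * ‖U j k‖ := by
              gcongr
              exact hw1 k
          _ = ‖U i k‖ * ‖U j k‖ := by ring
    _ ≤ ∑ k, (‖U i k‖ ^ 2 + ‖U j k‖ ^ 2) / 2 := by
        refine Finset.sum_le_sum fun k _ => ?_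
        have := two_mul_le_add_sq (‖U i k‖) (‖U j k‖)
        linarith
    _ = 1 := by
        rw [← Finset.sum_div, Finset.sum_add_distrib, unitary_row_norm_sq U hUmem i,
          unitary_row_norm_sq U hUmem j]
        norm_num

end EntryBound

/-- Every heat-kernel entry of the crux has modulus `≤ 1`, for every `L`, `U`, `m`, `t ≥ 0`. -/
theorem kernelEntry_le_one {L : ℕ} [NeZero L] (U : GaugeConfig 4 L SU3) (m : ℝ) {t : ℝ}
    (ht : 0 ≤ t) (x : TorusSite 4 L) (a b : Fin 3) (α β : Fin 4) :
    kernelEntry U m t x a b α β ≤ 1 :=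
  norm_exp_neg_smul_conjTranspose_mul_self_apply_le_one _ ht _ _

/-- **Fixed volume is trivial.** For each fixed `L` the inner statement of the crux holds with
`C = L⁴` (no smallness hypothesis, any `m`): entries are `≤ 1 ≤ L⁴/t²` for `t ≤ r² ≤ L²`.  Hence only
families with `L → ∞` can refute the crux and no finite counterexample search is meaningful. -/
theorem body_holds_at_fixed_volume (L : ℕ) [NeZero L] (U : GaugeConfig 4 L SU3) (m : ℝ)
    (x : TorusSite 4 L) (r : ℕ) (hrL : r ≤ L) (t : ℝ) (ht : 1 ≤ t) (htr : t ≤ (r : ℝ) ^ 2)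
    (a b : Fin 3) (α β : Fin 4) :
    kernelEntry U m t x a b α β ≤ (L : ℝ) ^ 4 / t ^ 2 := by
  have h1 := kernelEntry_le_one U m (zero_le_one.trans ht) x a b α β
  have hrL' : (r : ℝ) ^ 2 ≤ (L : ℝ) ^ 2 := by gcongr
  have ht2 : t ^ 2 ≤ (L : ℝ) ^ 4 := by
    have : t ≤ (L : ℝ) ^ 2 := htr.trans hrL'
    calc t ^ 2 ≤ ((L : ℝ) ^ 2) ^ 2 := by gcongr
      _ = (L : ℝ) ^ 4 := by ring
  have htpos : 0 < t ^ 2 := by positivity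
  calc kernelEntry U m t x a b α β ≤ 1 := h1
    _ = t ^ 2 / t ^ 2 := (div_self htpos.ne').symm
    _ ≤ (L : ℝ) ^ 4 / t ^ 2 := by gcongr

/-- The `0 < t` version of the crux (the lower window bound relaxed from `1 ≤ t` to `0 < t`). -/
def SmallFieldUltracontractivityPosT : Prop :=
  ∃ ε : ℝ, 0 < ε ∧ ∃ K : ℕ, ∃ C : ℝ, ∀ (L : ℕ) [NeZero L] (U : GaugeConfig 4 L SU3) (m : ℝ),
    m ∈ Set.Icc (-(1 / 2 : ℝ)) 1 → ∀ (x : TorusSite 4 L) (r : ℕ), 1 ≤ r → r ≤ L →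
    (∀ y : TorusSite 4 L, torusDist x y ≤ K * r → ∀ μ ν : Fin 4,
      3 - ((fundamentalRep (Fin 3)) (plaquetteHolonomy U y μ ν)).trace.re ≤ (ε / (r : ℝ) ^ 2) ^ 2) →
    ∀ (t : ℝ), 0 < t → t ≤ (r : ℝ) ^ 2 → ∀ (a b : Fin 3) (α β : Fin 4),
      kernelEntry U m t x a b α β ≤ C / t ^ 2

/-- **`1 ≤ t` is cosmetic**: the crux implies its own `0 < t` version (with `C ↦ max C 1`), because
entries are `≤ 1 ≤ max C 1 / t²` for `0 < t ≤ 1`. -/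
theorem posT_of_smallFieldUltracontractivity
    (h : Summit.QuantumFields.QCD.Theses.HeatSlicedQuarks.SmallFieldUltracontractivity) :
    SmallFieldUltracontractivityPosT := by
  obtain ⟨ε, hε, K, C, h⟩ := h
  refine ⟨ε, hε, K, max C 1, ?_⟩
  intro L _ U m hm x r hr hrL hsmall t ht htr a b α β
  rcases le_or_gt 1 t with h1t | ht1
  · calc kernelEntry U m t x a b α β ≤ C / t ^ 2 := h L U m hm x r hr hrL hsmall t h1t htr a b α β
      _ ≤ max C 1 / t ^ 2 := by gcongr; exact le_max_left _ _
  · have hle := kernelEntry_le_one U m ht.le x a b α β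
    have htpos : 0 < t ^ 2 := by positivity
    rw [le_div_iff₀ htpos]
    have : t ^ 2 ≤ 1 := by nlinarith
    calc kernelEntry U m t x a b α β * t ^ 2 ≤ 1 * 1 := by
          apply mul_le_mul hle this htpos.le zero_le_one
      _ = 1 := one_mul 1
      _ ≤ max C 1 := le_max_right _ _

/-! ## §A Load-bearing analysis: each order hypothesis on `t`, `r` is needed as typed -/

/-- The crux with the upper window bound `t ≤ r²` dropped. -/
def SmallFieldUltracontractivityWithout_t_le_rsq : Prop :=
  ∃ ε : ℝ, 0 < ε ∧ ∃ K : ℕ, ∃ C : ℝ, ∀ (L : ℕ) [NeZero L] (U : GaugeConfig 4 L SU3) (m : ℝ),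
    m ∈ Set.Icc (-(1 / 2 : ℝ)) 1 → ∀ (x : TorusSite 4 L) (r : ℕ), 1 ≤ r → r ≤ L →
    (∀ y : TorusSite 4 L, torusDist x y ≤ K * r → ∀ μ ν : Fin 4,
      3 - ((fundamentalRep (Fin 3)) (plaquetteHolonomy U y μ ν)).trace.re ≤ (ε / (r : ℝ) ^ 2) ^ 2) →
    ∀ (t : ℝ), 1 ≤ t → ∀ (a b : Fin 3) (α β : Fin 4), kernelEntry U m t x a b α β ≤ C / t ^ 2

/-- **`t ≤ r²` is load-bearing**: without it, `L = 1`, `U ≡ 1`, `m = 0` (heat kernel `≡ 1`) and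
`t → ∞` contradict `≤ C/t²`.  Physically the cap reflects Banks–Casher saturation at `t ≫ r²`; as
typed it is already forced by finite-volume zero modes. -/
theorem smallFieldUltracontractivity_false_without_t_le_rsq :
    ¬ SmallFieldUltracontractivityWithout_t_le_rsq := by
  rintro ⟨ε, -, K, C, h⟩
  have ht : (1 : ℝ) ≤ |C| + 1 := by have := abs_nonneg C; linarith
  have key := h 1 (freeCfg 1) 0 (by norm_num) (fun _ => 0) 1 le_rfl le_rfl
    (smallness_freeCfg 1 ε K 1 _) (|C| + 1) ht 0 0 0 0
  rw [kernelEntry_freeCfg_one_zero] at key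
  have hpos : (0 : ℝ) < (|C| + 1) ^ 2 := by positivity
  rw [le_div_iff₀ hpos, one_mul] at key
  nlinarith [le_abs_self C, abs_nonneg C]

/-- The crux with the volume bound `r ≤ L` dropped. -/
def SmallFieldUltracontractivityWithout_r_le_L : Prop :=
  ∃ ε : ℝ, 0 < ε ∧ ∃ K : ℕ, ∃ C : ℝ, ∀ (L : ℕ) [NeZero L] (U : GaugeConfig 4 L SU3) (m : ℝ),
    m ∈ Set.Icc (-(1 / 2 : ℝ)) 1 → ∀ (x : TorusSite 4 L) (r : ℕ), 1 ≤ r →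
    (∀ y : TorusSite 4 L, torusDist x y ≤ K * r → ∀ μ ν : Fin 4,
      3 - ((fundamentalRep (Fin 3)) (plaquetteHolonomy U y μ ν)).trace.re ≤ (ε / (r : ℝ) ^ 2) ^ 2) →
    ∀ (t : ℝ), 1 ≤ t → t ≤ (r : ℝ) ^ 2 → ∀ (a b : Fin 3) (α β : Fin 4),
      kernelEntry U m t x a b α β ≤ C / t ^ 2

/-- **`r ≤ L` is load-bearing**: without it, on `L = 1` take `r → ∞` and `t = r²`. -/
theorem smallFieldUltracontractivity_false_without_r_le_L :
    ¬ SmallFieldUltracontractivityWithout_r_le_L := by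
  rintro ⟨ε, -, K, C, h⟩
  -- r := ⌈|C|⌉₊ + 1, t := r²
  set r : ℕ := ⌈|C|⌉₊ + 1 with hr
  have hr1 : 1 ≤ r := by omega
  have hrC : |C| + 1 ≤ (r : ℝ) := by
    have := Nat.le_ceil |C|
    simp only [hr, Nat.cast_add, Nat.cast_one]
    linarith
  have hr1' : (1 : ℝ) ≤ (r : ℝ) := by exact_mod_cast hr1
  have ht : (1 : ℝ) ≤ (r : ℝ) ^ 2 := by nlinarith
  have key := h 1 (freeCfg 1) 0 (by norm_num) (fun _ => 0) r hr1
    (smallness_freeCfg 1 ε K r _) ((r : ℝ) ^ 2) ht le_rfl 0 0 0 0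
  rw [kernelEntry_freeCfg_one_zero] at key
  have hpos : (0 : ℝ) < ((r : ℝ) ^ 2) ^ 2 := by positivity
  rw [le_div_iff₀ hpos, one_mul] at key
  have h4 : (r : ℝ) ≤ ((r : ℝ) ^ 2) ^ 2 := by nlinarith
  nlinarith [le_abs_self C, abs_nonneg C]

/-- The crux with the lower window bound `1 ≤ t` dropped. -/
def SmallFieldUltracontractivityWithout_one_le_t : Prop :=
  ∃ ε : ℝ, 0 < ε ∧ ∃ K : ℕ, ∃ C : ℝ, ∀ (L : ℕ) [NeZero L] (U : GaugeConfig 4 L SU3) (m : ℝ),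
    m ∈ Set.Icc (-(1 / 2 : ℝ)) 1 → ∀ (x : TorusSite 4 L) (r : ℕ), 1 ≤ r → r ≤ L →
    (∀ y : TorusSite 4 L, torusDist x y ≤ K * r → ∀ μ ν : Fin 4,
      3 - ((fundamentalRep (Fin 3)) (plaquetteHolonomy U y μ ν)).trace.re ≤ (ε / (r : ℝ) ^ 2) ^ 2) →
    ∀ (t : ℝ), t ≤ (r : ℝ) ^ 2 → ∀ (a b : Fin 3) (α β : Fin 4),
      kernelEntry U m t x a b α β ≤ C / t ^ 2

/-- **`1 ≤ t` is load-bearing only through `t ≤ 0`**: at `t = 0` the kernel is the identity and the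
typed bound reads `1 ≤ C / 0 ^ 2 = 0` (junk division).  For `0 < t < 1` the crux's bound is
automatic once `C ≥ 1` (entries of `exp(-tH)`, `H ≥ 0`, have modulus `≤ 1`), so provers may read
`1 ≤ t` as `0 < t`. -/
theorem smallFieldUltracontractivity_false_without_one_le_t :
    ¬ SmallFieldUltracontractivityWithout_one_le_t := by
  rintro ⟨ε, -, K, C, h⟩
  have key := h 1 (freeCfg 1) 0 (by norm_num) (fun _ => 0) 1 le_rfl le_rfl
    (smallness_freeCfg 1 ε K 1 _) 0 (by positivity) 0 0 0 0
  rw [kernelEntry_freeCfg_one_zero] at key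
  norm_num at key

end

end Summit.QuantumFields.QCD.Theorems.SmallFieldUltracontractivity.Negative
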